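import Literature.GroupTheory.SpecificGroups.OrthogonalThreeSymmetricNilpotentOrbitsRankOne   -- (1∕2) (this seat): rank-one normal form `N(c)`, square classes, `formAdjoint_conj_of_mem`, conjugation bookkeeping; brings ★ p846873, ★ p846826
import Mathlib.NumberTheory.LegendreSymbol.QuadraticChar.Basic                                      -- `quadraticChar` (two square classes in a finite field)
import HarnessLib

/-!
# The `𝔭`-layer at a tame-ramified place, positive half (2∕2): the nilpotent `Ad O(J₀)`-orbits on the `J₀`-SYMMETRIC `3 × 3` matrices are classified by
# (rank, square class) — rank `2`: ONE orbit `R = E₂₁ + E₃₂`; over `𝔽_q` (`q` odd) the list is `0 ∣ N(1), N(ε) ∣ R`: FOUR orbits, so a class function takes ≤ 4 values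

Topic `Literature/GroupTheory/SpecificGroups`; namespace `Literature.GroupTheory.SpecificGroups`.  THEOREMS ONLY (no definition, no named fact, no instance, no notation,
no `sorry`).  Cell `pub/hodgecm-mathlib` (crux H413 = `stmt-HodgeConjecture-24833`), «S3-ram» seeding wave (LEAD F0P3a-plan (g12) T11-41∕T11-56; owner∕desk F0P3a-p06 (g15),
table v1.2 row «β V-INT-ram» re-aimed at the `𝔭`-layer per fold v4; seat F0P3-p03 (g14)); sequel of `OrthogonalThreeSymmetricNilpotentOrbitsRankOne` (rank one = square
classes), companion of ★ p846873 (`E₃₁ ≁ εE₃₁`) and ★ p846826 (`𝔨 = so(J₀)`: rank classifies).  SETTING as there: `J₀ = antidiag(1,1,1)`, `σ = id`, `O(J₀) = unitaryGroupOfForm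
id J₀`, `𝔭 = {X : J₀⁻¹ Xᵀ J₀ = X}`; here `2 ≠ 0`.  RANK TWO: `X ∈ 𝔭`, `X³ = 0 ≠ X²` ⇒ `X² ∈ 𝔭` is rank-one square-zero, so after a first `O(J₀)`-conjugation `X² = N(c)`,
which with `X·N(c) = X³ = 0` forces `X = eR + hE₃₁` (`e² = c`), and `n(h∕2e²)·diag(e, 1, e⁻¹) ∈ O(J₀)` conjugates this to `R`: ONE orbit (odd dimension: the `K[X]`-unit
obstruction `a` satisfies `a³ = det²`, a square).  Over a finite field of odd characteristic the orbit list is therefore `0`, `N(1)`, `N(ε)`, `R` (`ε` a non-square;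
pairwise distinct by rank and ★ p846873), and an `Ad O(J₀)`-invariant function takes at most FOUR values on the nilpotent part of `𝔭` — the value-table shape of the
depth-one ∕ second-layer strata-constancy organ at a tame-ramified place (p05 (g15) sf 380b85a5; F0P3-p02 (g16) L1 file), vs THREE values by rank on `𝔨` (★ p846826,
★ `LevelOnePieceStrataConstancyRamified`).
HONEST LABEL: HC_CM is proved only modulo the printed citations (the 2 remaining named inputs hLiu418 24832, h413 24833) until rung 0 closes; elementary `3 × 3` algebra,
nothing printed about the transfer is asserted; count-neutral Literature seeding.

* §3 **`exists_orthogonal_conj_eq_regularSymmetric`** (rank-two normal form `R`), **`exists_orthogonal_conj_eq_of_isNilpotent_of_rank_eq_two`** (consumer form),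
  **`exists_orthogonal_conj_eq_of_isNilpotent_of_rank_le_one_of_common_value`** (consumer form of (1∕2));
* §4 (finite fields) `exists_eq_sq_or_eq_sq_mul_of_not_isSquare`, **`exists_orthogonal_conj_mem_four_of_isNilpotent`**, **`apply_mem_four_of_conj_invariant_of_isNilpotent`**.

## References
* [CollingwoodMcGovern1993] D. Collingwood, W. McGovern, *Nilpotent Orbits in Semisimple Lie Algebras* (1993): §9.3 (rational∕real orbits for classical algebras; square classes).
* [Wilson2009] R. A. Wilson, *The Finite Simple Groups*, GTM 251 (2009): §3.7.1 p. 70, §3.7.2 p. 71 (`O₃(q)`, `SO₃(q) ≅ PGL₂(q)`).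
* [BruhatTits1972] F. Bruhat, J. Tits, *Groupes réductifs sur un corps local* I, Publ. Math. IHÉS 41 (1972): §10 (congruence filtrations; graded layers of parahorics).
-/

set_option autoImplicit false

open Matrix Literature.NumberTheory.Automorphic Literature.NumberTheory.Automorphic.HermitianLattice Literature.NumberTheory.Automorphic.UnitaryGroup
open Literature.LinearAlgebra.Matrix

namespace Literature.GroupTheory.SpecificGroups

variable {K : Type*} [Field K]


/-! ## §3 Rank two: the regular nilpotent `R = E₂₁ + E₃₂` is the unique orbit; the consumer-facing statements -/

section RankTwo

/-- **RANK-TWO NORMAL FORM**: `X ∈ 𝔭`, `X³ = 0 ≠ X²`, `2 ≠ 0` ⇒ `g X g⁻¹ = R = E₂₁ + E₃₂` for some `g ∈ O(J₀)` (`X² ∈ 𝔭` is rank-one square-zero, so WLOG `X² = N(c)`;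
then `X N(c) = X³ = 0` and `X² = N(c)` force `X = eR + hE₃₁` with `e² = c`, and `n(h∕2e²)·diag(e, 1, e⁻¹) ∈ O(J₀)` finishes). [cite: CollingwoodMcGovern1993, §9.3] -/
theorem exists_orthogonal_conj_eq_regularSymmetric (h2 : (2 : K) ≠ 0) {X : Matrix (Fin 3) (Fin 3) K}
    (hX : ((StdForm.antidiagonal 3).over K)⁻¹ * (X.map (RingHom.id K))ᵀ * (StdForm.antidiagonal 3).over K = X) (h3 : X ^ 3 = 0) (hsq : X * X ≠ 0) :
    ∃ g : GL (Fin 3) K, g ∈ unitaryGroupOfForm (RingHom.id K) ((StdForm.antidiagonal 3).over K) ∧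
      (g : Matrix (Fin 3) (Fin 3) K) * X * ((g⁻¹ : GL (Fin 3) K) : Matrix (Fin 3) (Fin 3) K) = !![0, 0, 0; 1, 0, 0; 0, 1, 0] := by
  have hJ := isUnit_det_antidiagonal_three_over (K := K)
  -- `X² ∈ 𝔭` is square-zero and non-zero
  have hX2 : ((StdForm.antidiagonal 3).over K)⁻¹ * ((X * X).map (RingHom.id K))ᵀ * (StdForm.antidiagonal 3).over K = X * X := by
    rw [formAdjoint_mul (RingHom.id K) hJ, hX]
  have h40 : X * X * (X * X) = 0 := by
    calc X * X * (X * X) = X ^ 3 * X := by rw [pow_succ, pow_two]; simp only [Matrix.mul_assoc]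
      _ = 0 := by rw [h3, Matrix.zero_mul]
  obtain ⟨c, hc, g, hg, hgX2⟩ := exists_orthogonal_conj_eq_cornerSymmetric hX2 h40 hsq
  -- `X₁ := g X g⁻¹ ∈ 𝔭`, `X₁² = N(c)`, `X₁ N(c) = X₁³ = 0`
  set X₁ : Matrix (Fin 3) (Fin 3) K := (g : Matrix (Fin 3) (Fin 3) K) * X * ((g⁻¹ : GL (Fin 3) K) : Matrix (Fin 3) (Fin 3) K) with hX₁
  have hθ1 : ((StdForm.antidiagonal 3).over K)⁻¹ * (X₁.map (RingHom.id K))ᵀ * (StdForm.antidiagonal 3).over K = X₁ := by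
    rw [hX₁, formAdjoint_conj_of_mem hg, hX]
  have hgg : ((g⁻¹ : GL (Fin 3) K) : Matrix (Fin 3) (Fin 3) K) * (g : Matrix (Fin 3) (Fin 3) K) = 1 := by
    rw [← Units.val_mul, inv_mul_cancel, Units.val_one]
  have h1sq : X₁ * X₁ = !![0, 0, 0; 0, 0, 0; c, 0, 0] := by
    rw [← hgX2, hX₁]
    calc (g : Matrix (Fin 3) (Fin 3) K) * X * ((g⁻¹ : GL (Fin 3) K) : Matrix (Fin 3) (Fin 3) K) *
          ((g : Matrix (Fin 3) (Fin 3) K) * X * ((g⁻¹ : GL (Fin 3) K) : Matrix (Fin 3) (Fin 3) K))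
        = (g : Matrix (Fin 3) (Fin 3) K) * X * (((g⁻¹ : GL (Fin 3) K) : Matrix (Fin 3) (Fin 3) K) * (g : Matrix (Fin 3) (Fin 3) K)) * X *
          ((g⁻¹ : GL (Fin 3) K) : Matrix (Fin 3) (Fin 3) K) := by simp only [Matrix.mul_assoc]
      _ = (g : Matrix (Fin 3) (Fin 3) K) * (X * X) * ((g⁻¹ : GL (Fin 3) K) : Matrix (Fin 3) (Fin 3) K) := by
          rw [hgg, Matrix.mul_one]; simp only [Matrix.mul_assoc]
  have h1cube : X₁ * !![0, 0, 0; 0, 0, 0; c, 0, 0] = 0 := by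
    rw [← h1sq]
    calc X₁ * (X₁ * X₁) = (g : Matrix (Fin 3) (Fin 3) K) * X * (((g⁻¹ : GL (Fin 3) K) : Matrix (Fin 3) (Fin 3) K) * (g : Matrix (Fin 3) (Fin 3) K)) * X *
          (((g⁻¹ : GL (Fin 3) K) : Matrix (Fin 3) (Fin 3) K) * (g : Matrix (Fin 3) (Fin 3) K)) * X * ((g⁻¹ : GL (Fin 3) K) : Matrix (Fin 3) (Fin 3) K) := by
            rw [hX₁]; simp only [Matrix.mul_assoc]
      _ = (g : Matrix (Fin 3) (Fin 3) K) * X ^ 3 * ((g⁻¹ : GL (Fin 3) K) : Matrix (Fin 3) (Fin 3) K) := by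
            rw [hgg, Matrix.mul_one, Matrix.mul_one, pow_succ, pow_two]; simp only [Matrix.mul_assoc]
      _ = 0 := by rw [h3, Matrix.mul_zero, Matrix.zero_mul]
  -- entries: `X₁ = !![a,b,d;e,f,b;h,e,a]`; column `(d, b, a)` dies; then `f = 0` and `e² = c`
  obtain ⟨hs1, hs2, hs3⟩ := (formAdjoint_id_eq_self_iff_entries X₁).1 hθ1
  have hcol : ∀ i, X₁ i 2 * c = 0 := fun i => by
    have := congrFun (congrFun h1cube i) 0
    simpa [Matrix.mul_apply, Fin.sum_univ_three] using this
  have hd : X₁ 0 2 = 0 := (mul_eq_zero.1 (hcol 0)).resolve_right hc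
  have hb : X₁ 1 2 = 0 := (mul_eq_zero.1 (hcol 1)).resolve_right hc
  have ha : X₁ 2 2 = 0 := (mul_eq_zero.1 (hcol 2)).resolve_right hc
  obtain ⟨e, f, h, hform⟩ : ∃ e f h : K, X₁ = !![0, 0, 0; e, f, 0; h, e, 0] :=
    ⟨X₁ 1 0, X₁ 1 1, X₁ 2 0, by
      ext i j; fin_cases i <;> fin_cases j
      · simpa using ha ▸ hs1.symm
      · simpa using hb ▸ hs2.symm
      · simpa using hd
      · simp
      · simp
      · simpa using hb
      · simp
      · simpa using hs3
      · simpa using ha⟩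
  rw [hform] at h1sq
  have hf : f = 0 := by
    have := congrFun (congrFun h1sq 1) 1
    simpa [Matrix.mul_apply, Fin.sum_univ_three] using this
  have he : e * e = c := by
    have := congrFun (congrFun h1sq 2) 0
    simpa [Matrix.mul_apply, Fin.sum_univ_three] using this
  have he0 : e ≠ 0 := by rintro rfl; exact hc (by rw [← he, mul_zero])
  subst hf
  -- the finishing conjugator `M = n(t)·diag(e, 1, e⁻¹)`, `t = h∕(2e²)`, with `θ(M) = M⁻¹`
  have hT : ((!![e, 0, 0; h / (2 * e ^ 2) * e, 1, 0; -((h / (2 * e ^ 2)) ^ 2 * e / 2), -(h / (2 * e ^ 2)), e⁻¹] : Matrix (Fin 3) (Fin 3) K).map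
        (RingHom.id K))ᵀ = !![e, h / (2 * e ^ 2) * e, -((h / (2 * e ^ 2)) ^ 2 * e / 2); 0, 1, -(h / (2 * e ^ 2)); 0, 0, e⁻¹] := by
      ext i j; fin_cases i <;> fin_cases j <;> rfl
  have hθW : ((StdForm.antidiagonal 3).over K)⁻¹ *
        ((!![e, 0, 0; h / (2 * e ^ 2) * e, 1, 0; -((h / (2 * e ^ 2)) ^ 2 * e / 2), -(h / (2 * e ^ 2)), e⁻¹] : Matrix (Fin 3) (Fin 3) K).map (RingHom.id K))ᵀ *
        (StdForm.antidiagonal 3).over K = !![e⁻¹, 0, 0; -(h / (2 * e ^ 2)), 1, 0; -((h / (2 * e ^ 2)) ^ 2 * e / 2), h / (2 * e ^ 2) * e, e] := by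
    rw [hT, antidiagonal_three_over_inv, antidiagonal_three_over_eq]
    ext i j; fin_cases i <;> fin_cases j <;> simp [Matrix.mul_apply, Fin.sum_univ_three]
  have h1 : ((StdForm.antidiagonal 3).over K)⁻¹ *
        ((!![e, 0, 0; h / (2 * e ^ 2) * e, 1, 0; -((h / (2 * e ^ 2)) ^ 2 * e / 2), -(h / (2 * e ^ 2)), e⁻¹] : Matrix (Fin 3) (Fin 3) K).map (RingHom.id K))ᵀ *
        (StdForm.antidiagonal 3).over K * !![e, 0, 0; h / (2 * e ^ 2) * e, 1, 0; -((h / (2 * e ^ 2)) ^ 2 * e / 2), -(h / (2 * e ^ 2)), e⁻¹] = 1 := by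
    rw [hθW]; ext i j; fin_cases i <;> fin_cases j <;> simp [Matrix.mul_apply, Fin.sum_univ_three, he0]
    all_goals field_simp; ring1
  obtain ⟨m, hm, hmW⟩ := exists_mem_unitaryGroupOfForm_coe_eq (RingHom.id K) hJ h1
  have hminv : ((m⁻¹ : GL (Fin 3) K) : Matrix (Fin 3) (Fin 3) K) =
      !![e⁻¹, 0, 0; -(h / (2 * e ^ 2)), 1, 0; -((h / (2 * e ^ 2)) ^ 2 * e / 2), h / (2 * e ^ 2) * e, e] := by
    rw [← formAdjoint_coe_eq_coe_inv (RingHom.id K) hJ hm, hmW, hθW]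
  refine ⟨m * g, mul_mem hm hg, ?_⟩
  rw [coe_mul_conj, ← hX₁, hform, hmW, hminv]
  ext i j; fin_cases i <;> fin_cases j <;> simp [Matrix.mul_apply, Fin.sum_univ_three, he0]
  all_goals field_simp; ring1

/-- **RANK TWO ⇒ ONE ORBIT** (consumer form): two NILPOTENT `X, X′ ∈ 𝔭` of rank `2` are `Ad O(J₀)`-conjugate (`2 ≠ 0`). [cite: CollingwoodMcGovern1993, §9.3] -/
theorem exists_orthogonal_conj_eq_of_isNilpotent_of_rank_eq_two (h2 : (2 : K) ≠ 0) {X X' : Matrix (Fin 3) (Fin 3) K}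
    (hX : ((StdForm.antidiagonal 3).over K)⁻¹ * (X.map (RingHom.id K))ᵀ * (StdForm.antidiagonal 3).over K = X)
    (hX' : ((StdForm.antidiagonal 3).over K)⁻¹ * (X'.map (RingHom.id K))ᵀ * (StdForm.antidiagonal 3).over K = X')
    (hnil : IsNilpotent X) (hnil' : IsNilpotent X') (hr : X.rank = 2) (hr' : X'.rank = 2) :
    ∃ g : GL (Fin 3) K, g ∈ unitaryGroupOfForm (RingHom.id K) ((StdForm.antidiagonal 3).over K) ∧
      (g : Matrix (Fin 3) (Fin 3) K) * X * ((g⁻¹ : GL (Fin 3) K) : Matrix (Fin 3) (Fin 3) K) = X' := by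
  have h3 := (isNilpotent_iff_pow_three_eq_zero X).1 hnil
  have h3' := (isNilpotent_iff_pow_three_eq_zero X').1 hnil'
  have hsq : X * X ≠ 0 := fun h => by have := rank_le_one_of_mul_self_eq_zero h; omega
  have hsq' : X' * X' ≠ 0 := fun h => by have := rank_le_one_of_mul_self_eq_zero h; omega
  obtain ⟨g, hg, hgX⟩ := exists_orthogonal_conj_eq_regularSymmetric h2 hX h3 hsq
  obtain ⟨g', hg', hgX'⟩ := exists_orthogonal_conj_eq_regularSymmetric h2 hX' h3' hsq'
  refine ⟨g'⁻¹ * g, mul_mem (inv_mem hg') hg, ?_⟩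
  rw [coe_mul_conj, hgX, ← hgX', inv_inv, coe_inv_mul_conj_mul_coe]

/-- **RANK ONE, consumer form**: two NILPOTENT `X, X′ ∈ 𝔭` of rank `≤ 1` whose symmetric forms `J₀X`, `J₀X′` represent a common non-zero value are `Ad O(J₀)`-conjugate.
[cite: CollingwoodMcGovern1993, §9.3] -/
theorem exists_orthogonal_conj_eq_of_isNilpotent_of_rank_le_one_of_common_value {X X' : Matrix (Fin 3) (Fin 3) K}
    (hX : ((StdForm.antidiagonal 3).over K)⁻¹ * (X.map (RingHom.id K))ᵀ * (StdForm.antidiagonal 3).over K = X)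
    (hX' : ((StdForm.antidiagonal 3).over K)⁻¹ * (X'.map (RingHom.id K))ᵀ * (StdForm.antidiagonal 3).over K = X')
    (hnil : IsNilpotent X) (hnil' : IsNilpotent X') (hr : X.rank ≤ 1) (hr' : X'.rank ≤ 1) {u u' : Fin 3 → K} {d : K} (hd : d ≠ 0)
    (hu : u ⬝ᵥ (((StdForm.antidiagonal 3).over K * X) *ᵥ u) = d) (hu' : u' ⬝ᵥ (((StdForm.antidiagonal 3).over K * X') *ᵥ u') = d) :
    ∃ g : GL (Fin 3) K, g ∈ unitaryGroupOfForm (RingHom.id K) ((StdForm.antidiagonal 3).over K) ∧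
      (g : Matrix (Fin 3) (Fin 3) K) * X * ((g⁻¹ : GL (Fin 3) K) : Matrix (Fin 3) (Fin 3) K) = X' :=
  exists_orthogonal_conj_eq_of_mul_self_eq_zero_of_common_value hX hX' (mul_self_eq_zero_of_rank_le_one_of_isNilpotent hr hnil)
    (mul_self_eq_zero_of_rank_le_one_of_isNilpotent hr' hnil') hd hu hu'

end RankTwo

/-! ## §4 Finite fields of odd characteristic: FOUR orbits `0 ∣ N(1), N(ε) ∣ R` -/

section Finite

/-- In a finite field, a non-zero `c` is a square or `ε` times a square, `ε` any non-square (`K×∕K×²` has order `2`). [folklore] [cite: Wilson2009, §3.7.2 p. 71] -/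
theorem exists_eq_sq_or_eq_sq_mul_of_not_isSquare [Fintype K] {ε : K} (hε : ¬ IsSquare ε) {c : K} (hc : c ≠ 0) :
    (∃ a : K, c = a ^ 2 * 1) ∨ ∃ a : K, c = a ^ 2 * ε := by
  classical
  have hε0 : ε ≠ 0 := fun h => hε ⟨0, by rw [h, mul_zero]⟩
  rcases quadraticChar_dichotomy hc with h1 | h1
  · obtain ⟨a, ha⟩ := (quadraticChar_one_iff_isSquare hc).1 h1
    exact Or.inl ⟨a, by rw [ha, sq, mul_one]⟩
  · right
    have hεχ : quadraticChar K ε = -1 := quadraticChar_neg_one_iff_not_isSquare.2 hε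
    have hprod : quadraticChar K (c * ε) = 1 := by rw [map_mul, h1, hεχ]; norm_num
    obtain ⟨b, hb⟩ := (quadraticChar_one_iff_isSquare (mul_ne_zero hc hε0)).1 hprod
    exact ⟨b / ε, by field_simp; linear_combination hb⟩

/-- **FOUR ORBITS over a finite field of odd characteristic**: every nilpotent `X ∈ 𝔭` is `Ad O(J₀)`-conjugate to one of `0`, `N(1) = E₃₁`, `N(ε) = εE₃₁`, `R = E₂₁ + E₃₂`
(`ε` any non-square; the four are pairwise non-conjugate by rank and ★ p846873). [cite: CollingwoodMcGovern1993, §9.3] [cite: Wilson2009, §3.7.2 p. 71] -/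
theorem exists_orthogonal_conj_mem_four_of_isNilpotent [Fintype K] (hK : ringChar K ≠ 2) {ε : K} (hε : ¬ IsSquare ε) {X : Matrix (Fin 3) (Fin 3) K}
    (hX : ((StdForm.antidiagonal 3).over K)⁻¹ * (X.map (RingHom.id K))ᵀ * (StdForm.antidiagonal 3).over K = X) (hnil : IsNilpotent X) :
    ∃ Y : Matrix (Fin 3) (Fin 3) K, (Y = 0 ∨ Y = !![0, 0, 0; 0, 0, 0; 1, 0, 0] ∨ Y = !![0, 0, 0; 0, 0, 0; ε, 0, 0] ∨ Y = !![0, 0, 0; 1, 0, 0; 0, 1, 0]) ∧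
      ∃ g : GL (Fin 3) K, g ∈ unitaryGroupOfForm (RingHom.id K) ((StdForm.antidiagonal 3).over K) ∧
        (g : Matrix (Fin 3) (Fin 3) K) * X * ((g⁻¹ : GL (Fin 3) K) : Matrix (Fin 3) (Fin 3) K) = Y := by
  have h2 : (2 : K) ≠ 0 := Ring.two_ne_zero hK
  have h3 := (isNilpotent_iff_pow_three_eq_zero X).1 hnil
  by_cases hX0 : X = 0
  · exact ⟨0, Or.inl rfl, 1, one_mem _, by rw [hX0, Matrix.mul_zero, Matrix.zero_mul]⟩
  by_cases hsq : X * X = 0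
  · obtain ⟨c, hc, g, hg, hgX⟩ := exists_orthogonal_conj_eq_cornerSymmetric hX hsq hX0
    rcases exists_eq_sq_or_eq_sq_mul_of_not_isSquare hε hc with hc1 | hcε
    · -- `c = a²·1`: `N(1) ~ N(c)`
      obtain ⟨g₁, hg₁, hg₁N⟩ := (exists_orthogonal_conj_cornerSymmetric_iff hc).2 hc1
      refine ⟨_, Or.inr (Or.inl rfl), g₁⁻¹ * g, mul_mem (inv_mem hg₁) hg, ?_⟩
      rw [coe_mul_conj, hgX, ← hg₁N, inv_inv, coe_inv_mul_conj_mul_coe]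
    · obtain ⟨g₁, hg₁, hg₁N⟩ := (exists_orthogonal_conj_cornerSymmetric_iff hc).2 hcε
      refine ⟨_, Or.inr (Or.inr (Or.inl rfl)), g₁⁻¹ * g, mul_mem (inv_mem hg₁) hg, ?_⟩
      rw [coe_mul_conj, hgX, ← hg₁N, inv_inv, coe_inv_mul_conj_mul_coe]
  · obtain ⟨g, hg, hgX⟩ := exists_orthogonal_conj_eq_regularSymmetric h2 hX h3 hsq
    exact ⟨_, Or.inr (Or.inr (Or.inr rfl)), g, hg, hgX⟩

/-- **An `Ad O(J₀)`-invariant function takes at most FOUR values on the nilpotent part of `𝔭`** (finite field, odd characteristic) — the value-table shape of a depth-one ∕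
second-layer strata-constancy organ at a tame-ramified place. [cite: CollingwoodMcGovern1993, §9.3] [cite: BruhatTits1972, §10] -/
theorem apply_mem_four_of_conj_invariant_of_isNilpotent [Fintype K] (hK : ringChar K ≠ 2) {ε : K} (hε : ¬ IsSquare ε) {α : Type*}
    (f : Matrix (Fin 3) (Fin 3) K → α)
    (hf : ∀ g ∈ unitaryGroupOfForm (RingHom.id K) ((StdForm.antidiagonal 3).over K), ∀ Y : Matrix (Fin 3) (Fin 3) K,
      f ((g : Matrix (Fin 3) (Fin 3) K) * Y * ((g⁻¹ : GL (Fin 3) K) : Matrix (Fin 3) (Fin 3) K)) = f Y)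
    {X : Matrix (Fin 3) (Fin 3) K} (hX : ((StdForm.antidiagonal 3).over K)⁻¹ * (X.map (RingHom.id K))ᵀ * (StdForm.antidiagonal 3).over K = X)
    (hnil : IsNilpotent X) :
    f X = f 0 ∨ f X = f !![0, 0, 0; 0, 0, 0; 1, 0, 0] ∨ f X = f !![0, 0, 0; 0, 0, 0; ε, 0, 0] ∨ f X = f !![0, 0, 0; 1, 0, 0; 0, 1, 0] := by
  obtain ⟨Y, hY, g, hg, hgX⟩ := exists_orthogonal_conj_mem_four_of_isNilpotent hK hε hX hnil
  have hfX : f X = f Y := by rw [← hgX, hf g hg X]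
  rw [hfX]
  rcases hY with rfl | rfl | rfl | rfl
  · exact Or.inl rfl
  · exact Or.inr (Or.inl rfl)
  · exact Or.inr (Or.inr (Or.inl rfl))
  · exact Or.inr (Or.inr (Or.inr rfl))

end Finite

end Literature.GroupTheory.SpecificGroups
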